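import Summits.AtomisticToContinuum.BoseEinsteinCondensation.Theses.BECParticleIncrement

/-! Sketch for the crux idea `bogoliubov-rate-induction` (lens: strengthen) on `IncrementBound` (stmt-12320). -/

namespace Summit.AtomisticToContinuum.BoseEinsteinCondensation.Cruxes.IncrementBound.BogoliubovRate

open Literature.MathematicalPhysics.QuantumManyBody.BoseGas
open Summit.AtomisticToContinuum.BoseEinsteinCondensation.Theses.BECParticleIncrement

noncomputable section

/-- S⁺ — the per-particle increment AT BOGOLIUBOV RATE in the fixed Dirichlet box: the condensate number grows
by at least `1 − C(√(ρ_{M+1} a³) + a/L)` when one particle is added, throughout the dilute range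
(`ρ_{M+1} = (M+1)/L³`, `a` the scattering length; one loop: `dN₀/dN = 1 − (4/√π)√(ρa³)`). Telescoped it is
near-complete BEC `λ_max(γ_M) ≥ M(1 − C'√(ρ_M a³) − C a/L)` — the induction hypothesis the impurity mechanism of
`BootstrapStep` actually consumes. -/
def IncrementBoundSharp : Prop :=
  ∀ v : ℝ → ENNReal, IsRepulsiveFiniteRange v → ∃ C ρ₁ L₀ : ℝ, 0 ≤ C ∧ 0 < ρ₁ ∧ ∀ L : ℝ, L₀ ≤ L →
    ∀ M : ℕ, (M : ℝ) + 1 ≤ ρ₁ * L ^ 3 →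
      condensateNumber v M L + ENNReal.ofReal (1 - C * (Real.sqrt (((M : ℝ) + 1) / L ^ 3 *
          (scatteringLength v).toReal ^ 3) + (scatteringLength v).toReal / L)) ≤
        condensateNumber v (M + 1) L

/-- The sharp bulk step: the inductive step with the induction hypothesis carried AT BOGOLIUBOV RATE (near-complete
BEC of the bath, constant `C`), the response inequality as in the route, and the SAME constant `C` reproduced at
`M` (no loss: the step must compute the increment to precision `o(√(ρa³))`, i.e. second order exactly). -/
def BootstrapStepSharp : Prop :=
  ∀ v : ℝ → ENNReal, IsRepulsiveFiniteRange v → ∀ C K : ℝ, ∃ g₀ ρ₁ L₀ : ℝ, 0 < ρ₁ ∧ ∀ L : ℝ, L₀ ≤ L →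
    ∀ M : ℕ, g₀ * L < ((M : ℝ) + 1) * (scatteringLength v).toReal → (M : ℝ) + 1 ≤ ρ₁ * L ^ 3 →
      (∀ M' : ℕ, M' < M → condensateNumber v M' L + ENNReal.ofReal (1 - K * (Real.sqrt (((M' : ℝ) + 1) / L ^ 3 *
          (scatteringLength v).toReal ^ 3) + (scatteringLength v).toReal / L)) ≤ condensateNumber v (M' + 1) L) →
      (∀ M' : ℕ, M' ≤ M + 1 → ∀ k : EuclideanSpace ℝ (Fin 3), k ≠ 0 → ∃ t₀ : ℝ, 0 < t₀ ∧ ∀ t : ℝ, 0 < t → t ≤ t₀ → 2 * Literature.MathematicalPhysics.QuantumManyBody.BoseGas.groundStateEnergy v M' L + ENNReal.ofReal (2 * t * (M' : ℝ)) ≤ (⨅ Ψ : Literature.MathematicalPhysics.QuantumManyBody.BoseGas.TrialState M' L, (Literature.MathematicalPhysics.QuantumManyBody.BoseGas.energy v Ψ + ∫⁻ X, (∑ j : Fin M', ENNReal.ofReal (t * (1 + Real.cos (∑ i : Fin 3, k i * X j i)))) * (‖Ψ.ψ X‖₊ : ENNReal) ^ 2)) + (⨅ Ψ : Literature.MathematicalPhysics.QuantumManyBody.BoseGas.TrialState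 M' L, (Literature.MathematicalPhysics.QuantumManyBody.BoseGas.energy v Ψ + ∫⁻ X, (∑ j : Fin M', ENNReal.ofReal (t * (1 - Real.cos (∑ i : Fin 3, k i * X j i)))) * (‖Ψ.ψ X‖₊ : ENNReal) ^ 2)) + ENNReal.ofReal (C * t ^ 2 * (M' : ℝ) / (‖k‖ ^ 2 + (M' : ℝ) / L ^ 3 * (Literature.MathematicalPhysics.QuantumManyBody.BoseGas.scatteringLength v).toReal))) →
      condensateNumber v M L + ENNReal.ofReal (1 - K * (Real.sqrt (((M : ℝ) + 1) / L ^ 3 *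
          (scatteringLength v).toReal ^ 3) + (scatteringLength v).toReal / L)) ≤ condensateNumber v (M + 1) L

/-- First lemma of the line (routine real arithmetic, to be proved by the lead): S⁺ feeds X — choose `ρ₁` with
`C√(ρ₁a³) ≤ 1/4` and `L₀ ≥ 4Ca`, so that the Bogoliubov-rate increment is `≥ 1/2` in the dilute range. -/
theorem incrementBound_of_sharp : IncrementBoundSharp → IncrementBound := by
  intro h v hv
  obtain ⟨C, ρ₁, L₀, hC, hρ₁, hinc⟩ := h v hv
  set a : ℝ := (scatteringLength v).toReal with ha_def
  have ha : 0 ≤ a := ENNReal.toReal_nonneg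
  -- the dilute threshold: C √(ρ⋆ a³) ≤ 1/4
  set ρs : ℝ := 1 / (16 * (C ^ 2 + 1) * (a ^ 3 + 1)) with hρs_def
  have hCa : 0 < 16 * (C ^ 2 + 1) * (a ^ 3 + 1) := by positivity
  have hρs : 0 < ρs := by rw [hρs_def]; positivity
  refine ⟨min ρ₁ ρs, max L₀ (4 * C * a + 1), lt_min hρ₁ hρs, ?_⟩
  intro L hL M hM
  have hL₀ : L₀ ≤ L := le_trans (le_max_left _ _) hL
  have hL1 : 4 * C * a + 1 ≤ L := le_trans (le_max_right _ _) hL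
  have hLpos : 0 < L := by nlinarith [mul_nonneg (mul_nonneg (by norm_num : (0:ℝ) ≤ 4) hC) ha]
  have hL3 : 0 < L ^ 3 := pow_pos hLpos 3
  have hM₁ : (M : ℝ) + 1 ≤ ρ₁ * L ^ 3 :=
    le_trans hM (mul_le_mul_of_nonneg_right (min_le_left _ _) hL3.le)
  have hMs : (M : ℝ) + 1 ≤ ρs * L ^ 3 :=
    le_trans hM (mul_le_mul_of_nonneg_right (min_le_right _ _) hL3.le)
  -- (i) the square-root term: C · √(ρ_{M+1} a³) ≤ 1/4
  have hx : ((M : ℝ) + 1) / L ^ 3 * a ^ 3 ≤ 1 / (16 * (C ^ 2 + 1)) := by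
    have h1 : ((M : ℝ) + 1) / L ^ 3 ≤ ρs := by
      rw [div_le_iff₀ hL3]; exact hMs
    have h2 : ((M : ℝ) + 1) / L ^ 3 * a ^ 3 ≤ ρs * a ^ 3 :=
      mul_le_mul_of_nonneg_right h1 (pow_nonneg ha 3)
    have h3 : ρs * a ^ 3 ≤ 1 / (16 * (C ^ 2 + 1)) := by
      rw [hρs_def, div_mul_eq_mul_div, one_mul, div_le_div_iff₀ hCa (by positivity)]
      nlinarith [pow_nonneg ha 3, sq_nonneg C, mul_nonneg (pow_nonneg ha 3) (sq_nonneg C)]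
    exact le_trans h2 h3
  have hx0 : 0 ≤ ((M : ℝ) + 1) / L ^ 3 * a ^ 3 := by positivity
  have hsqrt : C * Real.sqrt (((M : ℝ) + 1) / L ^ 3 * a ^ 3) ≤ 1 / 4 := by
    -- square both sides: (C √x)² = C² x ≤ C²/(16 (C²+1)) ≤ 1/16
    have hsq : (C * Real.sqrt (((M : ℝ) + 1) / L ^ 3 * a ^ 3)) ^ 2 ≤ (1 / 4) ^ 2 := by
      rw [mul_pow, Real.sq_sqrt hx0]
      have h1 : C ^ 2 * (((M : ℝ) + 1) / L ^ 3 * a ^ 3) ≤ C ^ 2 * (1 / (16 * (C ^ 2 + 1))) :=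
        mul_le_mul_of_nonneg_left hx (sq_nonneg C)
      have h2 : C ^ 2 * (1 / (16 * (C ^ 2 + 1))) ≤ (1 / 4) ^ 2 := by
        rw [mul_one_div, div_le_iff₀ (by positivity)]
        nlinarith [sq_nonneg C]
      exact le_trans h1 h2
    have hnn : 0 ≤ C * Real.sqrt (((M : ℝ) + 1) / L ^ 3 * a ^ 3) :=
      mul_nonneg hC (Real.sqrt_nonneg _)
    nlinarith [hsq, hnn]
  -- (ii) the finite-size term: C · a/L ≤ 1/4
  have hfs : C * (a / L) ≤ 1 / 4 := by
    rw [mul_div_assoc', div_le_iff₀ hLpos]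
    nlinarith [mul_nonneg hC ha]
  -- hence the Bogoliubov-rate increment is at least 1/2
  have hhalf : (2⁻¹ : ENNReal) ≤ ENNReal.ofReal (1 - C * (Real.sqrt (((M : ℝ) + 1) / L ^ 3 * a ^ 3) + a / L)) := by
    have h2 : (2⁻¹ : ENNReal) = ENNReal.ofReal ((1 : ℝ) / 2) := by
      rw [one_div, ENNReal.ofReal_inv_of_pos (by norm_num : (0 : ℝ) < 2), ENNReal.ofReal_ofNat]
    rw [h2]
    refine ENNReal.ofReal_le_ofReal ?_
    nlinarith [hsqrt, hfs]
  calc condensateNumber v M L + 2⁻¹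
      ≤ condensateNumber v M L +
          ENNReal.ofReal (1 - C * (Real.sqrt (((M : ℝ) + 1) / L ^ 3 * a ^ 3) + a / L)) :=
        add_le_add le_rfl hhalf
    _ ≤ condensateNumber v (M + 1) L := hinc L hL₀ M hM₁

end

end Summit.AtomisticToContinuum.BoseEinsteinCondensation.Cruxes.IncrementBound.BogoliubovRate
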